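import Summits.KontsevichZagierPeriods.Zeta5Search.WedgeDictionaryLevelDescentWeights
import Summits.KontsevichZagierPeriods.Zeta5Search.DualSeriesLemma19Record
import HarnessLib

/-!
# Level descent (LD@N): symmetry of the truncated weight and of the raised shapes under permutations of the slot triple {1,2,7}

HONEST FRAMING: systematic search; no irrationality claim unless certified.

OUR work (Summit side; planner gen-1 g7, 2026-08-20; memo `pub-zeta5-gen-1/D2-LD-PROOF-g7.md` §5): the inductive proof of the level descent moves in the
(s,t)-plane for ANY two slots `s, t` of the triple `T = {1,2,7}` (mover = middle value, sideways = minimum), while cross-contiguity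
(`WedgeDictionaryCrossContiguity`) and the termwise weight relation (`WedgeDictionaryLevelDescentWeightsProof.ldW_cross`) are proved in the (2,7)-plane.
The transport is by the symmetry proved here (all PROVED, no `sorry`, no hypothesis beyond the stated ones):

* `ldW_swap` — the truncated symmetric weight `ldW b m` (`WedgeDictionaryLevelDescentWeights`) is invariant under `b ↦ b ∘ swap j k` for `j, k ∈ {1,2,7}`
  (`ldWeightSym_swap` for the formula — the `{1,2,7}`-product is re-indexed by the swap, `Equiv.Perm.prod_comp`; `ldSupp_swap` for the support);
  named statement `ldW_swap_stmt`, witness `ldW_swap_holds`.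
* `bump_swap` / `coeffU_bump_swap`, `coeffW_bump_swap`, `coeffV_bump_swap` — raising slot 7 of `b ∘ swap j k` is raising slot `swap j k 7` of `b`, read
  through the slot symmetry of `U`, `W`, `V` (`coeffU_swap`, `coeffW_swap`, `coeffV_swap`); with the j-freeness of the wedges
  (`WedgeDictionaryCrossContiguity.wedgeSlotFree`) this makes both sides of (LD@N) `{1,2,7}`-symmetric.
What this is NOT: anything about irrationality; pure bookkeeping identities between rational numbers.
-/

open Finset

namespace Summit.KontsevichZagierPeriods.Zeta5Search.WedgeDictionary

open Summit.KontsevichZagierPeriods.Zeta5Search.DualSeries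
open Summit.KontsevichZagierPeriods.Zeta5Search.DualSeriesLemma19 (coeffV_swap)

/-- A swap of two slots of the triple fixes every slot outside the triple. -/
theorem swap_fix {j k : ℕ} (hj : j ∈ ({1, 2, 7} : Finset ℕ)) (hk : k ∈ ({1, 2, 7} : Finset ℕ)) {x : ℕ}
    (hx : x ∉ ({1, 2, 7} : Finset ℕ)) : Equiv.swap j k x = x :=
  Equiv.swap_apply_of_ne_of_ne (by rintro rfl; exact hx hj) (by rintro rfl; exact hx hk)

section
variable (b : ℕ → ℤ) {j k : ℕ} (hj : j ∈ ({1, 2, 7} : Finset ℕ)) (hk : k ∈ ({1, 2, 7} : Finset ℕ))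
include hj hk

/-- Slot `0` is fixed. -/
theorem swap_b0 : b (Equiv.swap j k 0) = b 0 := by rw [swap_fix hj hk (by decide)]

/-- The slots `B = {3,4,5,6}` are fixed. -/
theorem swap_bB {x : ℕ} (hx : x ∈ Icc 3 6) : b (Equiv.swap j k x) = b x := by
  rw [swap_fix hj hk]
  simp only [mem_Icc] at hx
  simp only [mem_insert, mem_singleton]
  omega

/-- `Σ_B` is invariant. -/
theorem sumB_swap : sumB (fun i => b (Equiv.swap j k i)) = sumB b := by
  simp only [sumB]
  rw [swap_bB b hj hk (by simp), swap_bB b hj hk (by simp), swap_bB b hj hk (by simp), swap_bB b hj hk (by simp)]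

/-- `σ = b₁ + b₂ + b₇` is invariant. -/
theorem sigmaT_swap : sigmaT (fun i => b (Equiv.swap j k i)) = sigmaT b := by
  simp only [mem_insert, mem_singleton] at hj hk
  rcases hj with rfl | rfl | rfl <;> rcases hk with rfl | rfl | rfl <;>
    simp [sigmaT, Equiv.swap_apply_def] <;> ring

/-- `d = 3N − Σ b_j` is invariant. -/
theorem dOf_swap : dOf (fun i => b (Equiv.swap j k i)) = dOf b := by
  simp only [mem_insert, mem_singleton] at hj hk
  rcases hj with rfl | rfl | rfl <;> rcases hk with rfl | rfl | rfl <;>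
    simp [dOf, sum_range_succ, Equiv.swap_apply_def] <;> ring

/-- The symmetric weight formula is invariant (the `{1,2,7}`-product is re-indexed by the swap). -/
theorem ldWeightSym_swap (m : ℤ) : ldWeightSym (fun i => b (Equiv.swap j k i)) m = ldWeightSym b m := by
  have h0 := swap_b0 b hj hk
  have hP : (∏ t ∈ ({1, 2, 7} : Finset ℕ), facQ (b (Equiv.swap j k t)) /
        (facQ (b (Equiv.swap j k t) - m) * ∏ x ∈ Icc 3 6, facQ (b (Equiv.swap j k 0) - b (Equiv.swap j k t) - b (Equiv.swap j k x)))) =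
      ∏ t ∈ ({1, 2, 7} : Finset ℕ), facQ (b t) / (facQ (b t - m) * ∏ x ∈ Icc 3 6, facQ (b 0 - b t - b x)) := by
    have inner : ∀ t, (∏ x ∈ Icc 3 6, facQ (b (Equiv.swap j k 0) - b (Equiv.swap j k t) - b (Equiv.swap j k x))) =
        ∏ x ∈ Icc 3 6, facQ (b 0 - b (Equiv.swap j k t) - b x) := fun t =>
      prod_congr rfl fun x hx => by rw [h0, swap_bB b hj hk hx]
    simp_rw [inner]
    exact Equiv.Perm.prod_comp (Equiv.swap j k) _
      (fun v => facQ (b v) / (facQ (b v - m) * ∏ x ∈ Icc 3 6, facQ (b 0 - b v - b x)))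
      (fun a ha => by
        simp only [Set.mem_setOf_eq] at ha
        by_contra h
        exact ha (swap_fix hj hk h))
  have hQ : (∏ x ∈ Icc 3 6, facQ (b (Equiv.swap j k 0) - b (Equiv.swap j k x) - m)) = ∏ x ∈ Icc 3 6, facQ (b 0 - b x - m) :=
    prod_congr rfl fun x hx => by rw [h0, swap_bB b hj hk hx]
  simp only [ldWeightSym]
  rw [sumB_swap b hj hk, sigmaT_swap b hj hk, dOf_swap b hj hk, hP, hQ, h0]

/-- The support is invariant. -/
theorem ldSupp_swap (m : ℤ) : ldSupp (fun i => b (Equiv.swap j k i)) m ↔ ldSupp b m := by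
  have h0 := swap_b0 b hj hk
  have hT : ∀ t ∈ ({1, 2, 7} : Finset ℕ), Equiv.swap j k t ∈ ({1, 2, 7} : Finset ℕ) := by
    intro t ht
    simp only [mem_insert, mem_singleton] at hj hk ht ⊢
    rcases hj with rfl | rfl | rfl <;> rcases hk with rfl | rfl | rfl <;> rcases ht with rfl | rfl | rfl <;>
      simp [Equiv.swap_apply_def]
  have part1 : (∀ t ∈ ({1, 2, 7} : Finset ℕ), ∀ x ∈ Icc 3 6,
        0 ≤ b (Equiv.swap j k 0) - b (Equiv.swap j k t) - b (Equiv.swap j k x)) ↔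
      ∀ t ∈ ({1, 2, 7} : Finset ℕ), ∀ x ∈ Icc 3 6, 0 ≤ b 0 - b t - b x := by
    constructor
    · intro H t ht x hx
      have := H (Equiv.swap j k t) (hT t ht) x hx
      rwa [h0, Equiv.swap_apply_self, swap_bB b hj hk hx] at this
    · intro H t ht x hx
      rw [h0, swap_bB b hj hk hx]
      exact H _ (hT t ht) x hx
  simp only [ldSupp]
  rw [part1, sigmaT_swap b hj hk, h0]
  simp only [mem_insert, mem_singleton] at hj hk
  rcases hj with rfl | rfl | rfl <;> rcases hk with rfl | rfl | rfl <;> simp [Equiv.swap_apply_def] <;> omega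

/-- **The truncated weight is `{1,2,7}`-symmetric.** -/
theorem ldW_swap (m : ℤ) : ldW (fun i => b (Equiv.swap j k i)) m = ldW b m := by
  simp only [ldW]
  rw [ldWeightSym_swap b hj hk]
  by_cases h : ldSupp b m
  · rw [if_pos h, if_pos ((ldSupp_swap b hj hk m).2 h)]
  · rw [if_neg h, if_neg (fun h' => h ((ldSupp_swap b hj hk m).1 h'))]

end

/-- STATEMENT (PROVED below as `ldW_swap_holds`): the truncated level-descent weight is invariant under the swaps of the slot triple `{1,2,7}`. -/
def ldW_swap_stmt : Prop :=
  ∀ (b : ℕ → ℤ) (j k : ℕ) (m : ℤ), j ∈ ({1, 2, 7} : Finset ℕ) → k ∈ ({1, 2, 7} : Finset ℕ) →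
    ldW (fun i => b (Equiv.swap j k i)) m = ldW b m

/-- `ldW_swap_stmt` holds. -/
theorem ldW_swap_holds : ldW_swap_stmt := fun b _ _ m hj hk => ldW_swap b hj hk m

/-! ## Raising slot 7 of a swapped shape -/

/-- `bump (b ∘ swap j k) 6 = (b + e_{swap j k 7}) ∘ swap j k`. -/
theorem bump_swap (b : ℕ → ℤ) (j k : ℕ) :
    bump (fun i => b (Equiv.swap j k i)) 6 =
      fun i => Function.update b (Equiv.swap j k 7) (b (Equiv.swap j k 7) + 1) (Equiv.swap j k i) := by
  funext i
  simp only [bump, Nat.reduceAdd, Function.update_apply]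
  by_cases hi : i = 7
  · subst hi; simp
  · have : Equiv.swap j k i ≠ Equiv.swap j k 7 := fun h => hi ((Equiv.swap j k).injective h)
    simp [hi, this]

section
variable (b : ℕ → ℤ) {j k : ℕ} (hj : j ∈ Icc 1 7) (hk : k ∈ Icc 1 7)
include hj hk

/-- `U((b ∘ swap) + e₇) = U(b + e_{swap 7})`. -/
theorem coeffU_bump_swap : coeffU (bump (fun i => b (Equiv.swap j k i)) 6) =
    coeffU (Function.update b (Equiv.swap j k 7) (b (Equiv.swap j k 7) + 1)) := by
  rw [bump_swap]; exact coeffU_swap _ hj hk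

/-- `W((b ∘ swap) + e₇) = W(b + e_{swap 7})`. -/
theorem coeffW_bump_swap : coeffW (bump (fun i => b (Equiv.swap j k i)) 6) =
    coeffW (Function.update b (Equiv.swap j k 7) (b (Equiv.swap j k 7) + 1)) := by
  rw [bump_swap]; exact coeffW_swap _ hj hk

/-- `V((b ∘ swap) + e₇) = V(b + e_{swap 7})`. -/
theorem coeffV_bump_swap : coeffV (bump (fun i => b (Equiv.swap j k i)) 6) =
    coeffV (Function.update b (Equiv.swap j k 7) (b (Equiv.swap j k 7) + 1)) := by
  rw [bump_swap]; exact coeffV_swap _ hj hk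

/-- `casUV (b ∘ swap j k)` is the slot-`(swap j k 7)` wedge of `U ∧ V` at `b` (combine with `wedgeSlotFree` to get `casUV b`). -/
theorem casUV_swap_eq : casUV (fun i => b (Equiv.swap j k i)) =
    coeffU b * coeffV (Function.update b (Equiv.swap j k 7) (b (Equiv.swap j k 7) + 1)) -
      coeffU (Function.update b (Equiv.swap j k 7) (b (Equiv.swap j k 7) + 1)) * coeffV b := by
  simp only [casUV]
  rw [coeffU_bump_swap b hj hk, coeffV_bump_swap b hj hk, coeffU_swap b hj hk, coeffV_swap b hj hk]

end

/-- STATEMENT (PROVED below as `casUV_swap_holds`): `casUV (b ∘ swap j k)` is the slot-`(swap j k 7)` wedge of `U ∧ V` at `b`, `j, k ∈ Icc 1 7`. -/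
def casUV_swap_stmt : Prop :=
  ∀ (b : ℕ → ℤ) (j k : ℕ), j ∈ Icc 1 7 → k ∈ Icc 1 7 →
    casUV (fun i => b (Equiv.swap j k i)) =
      coeffU b * coeffV (Function.update b (Equiv.swap j k 7) (b (Equiv.swap j k 7) + 1)) -
        coeffU (Function.update b (Equiv.swap j k 7) (b (Equiv.swap j k 7) + 1)) * coeffV b

/-- `casUV_swap_stmt` holds. -/
theorem casUV_swap_holds : casUV_swap_stmt := fun b _ _ hj hk => casUV_swap_eq b hj hk

/-- The same for `U ∧ W` (the wedge `casUW` lives in `WedgeDictionaryCrossContiguity`; stated here on the expression). -/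
def casUW_swap_stmt : Prop :=
  ∀ (b : ℕ → ℤ) (j k : ℕ), j ∈ Icc 1 7 → k ∈ Icc 1 7 →
    coeffU (fun i => b (Equiv.swap j k i)) * coeffW (bump (fun i => b (Equiv.swap j k i)) 6) -
        coeffU (bump (fun i => b (Equiv.swap j k i)) 6) * coeffW (fun i => b (Equiv.swap j k i)) =
      coeffU b * coeffW (Function.update b (Equiv.swap j k 7) (b (Equiv.swap j k 7) + 1)) -
        coeffU (Function.update b (Equiv.swap j k 7) (b (Equiv.swap j k 7) + 1)) * coeffW b

/-- `casUW_swap_stmt` holds. -/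
theorem casUW_swap_holds : casUW_swap_stmt := fun b _ _ hj hk => by
  rw [coeffU_bump_swap b hj hk, coeffW_bump_swap b hj hk, coeffU_swap b hj hk, coeffW_swap b hj hk]

end Summit.KontsevichZagierPeriods.Zeta5Search.WedgeDictionary
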